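import Literature.Analysis.ODE.TorusFlowHigherDerivatives
import Literature.Analysis.FunctionSpaces.TorusCompositionRemainder
import Mathlib.Analysis.Complex.Exponential
import HarnessLib

/-!
# Armstrong–Vicol App. A Prop. 7.11: analytic-type bounds on all space derivatives of the flow map —
# `theorem Torus.ArmstrongVicol2025_flowGrad_holds`

Analysis/ODE proof file (theorems only; no definitions, no named facts). We discharge the named fact
`Torus.ArmstrongVicol2025_flowGrad` (`TorusAnalyticComposition`) following the printed induction
(arXiv:2305.05048 pp. 73–74): for the flow `X = id + proj∘D` of `f` with `⟦f(t)⟧_{n,R_f} ≤ C_f`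
(`1 ≤ n ≤ N`), on `|t| ≤ T = 1/(4dC_fR_f)` one propagates, in the sup-over-components bookkeeping,
`|∂^K X_j(t,x)| ≤ W_s ρ_tˢ/((s+1)² d R_f)`, `ρ_t = 8dR_f(1 + 8dC_fR_f|t|)`, `W_1 = ½`, `W_{s+1} = (s−½)W_s`
(`W_s = (−1)^{s−1} binom(½,s)·s!`): the base `s = 1` is Grönwall on the variational equation
(`|∂ₖDᵢ(t,x)| ≤ 8dC_fR_f|t|`), the step is the "chain rule on steroids"
(`TorusFlow.hasDerivAt_iterPartialDeriv_disp` + `Torus.iteratedFDeriv_comp_sub_eq_sum`), the bound on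
`E_old` (`Torus.norm_faaDiBrunoRemainder_le_of_coord`, Lemma 7.3 in total-order form) and Grönwall with
forcing (`TorusFlow.norm_le_exp_mul_integral_of_norm_deriv_le`, `∫₀ᵗ(1+Bs)ˢds ≤ (1+Bt)^{s+1}/(B(s+1))`,
`e^{1/16} < 16/15`); negative times by time reversal; finally `⟦∇X(t)⟧_{n,ρ_t} ≤ 6d` from the order-`n+1`
bound (`4W_{n+1} ≤ n!`, `ρ_t ≤ 24dR_f`).

## References

* S. Armstrong, V. Vicol, *Anomalous diffusion by fractal homogenization*, Ann. PDE 11 (2025),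
  arXiv:2305.05048, App. A Prop. 7.10 (first display), Prop. 7.11 ((e.ODE.flow.estimate),
  (eq:Dn:Psi:induction), (eq:chain:rule:steroids), (eq:E:old:bound)). [`ArmstrongVicol2025`]
* P. Hartman, *Ordinary Differential Equations* (2nd ed., SIAM 2002), Ch. V Thm 3.1. [`Hartman2002`]
-/

noncomputable section

open Set Function Filter MeasureTheory Finset
open scoped Topology Nat ContDiff

namespace Literature.Analysis.ODE

namespace TorusFlow

open Literature.Analysis.FunctionSpaces Literature.Analysis.FunctionSpaces.Torus

variable {d : Type*} [Fintype d] [DecidableEq d]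

/-! ## §1 The weights `W_s = ½ Π_{j<s-1}(j+½)` -/

/-- `W_1 = ½`. [cite: ArmstrongVicol2025, App. A Prop. 7.11 ((eq:Dn:Psi:induction), binom(½,1) = ½)] -/
theorem avWeight_one : (1 / 2 : ℝ) * ∏ j ∈ Finset.range (1 - 1), ((j : ℝ) + 1 / 2) = 1 / 2 := by simp

/-- `W_{s+1} = (s − ½) W_s` for `s ≥ 1`. [cite: ArmstrongVicol2025, App. A Prop. 7.11 (ratio of consecutive binom(½,·))] -/
theorem avWeight_succ {s : ℕ} (hs : 1 ≤ s) :
    (1 / 2 : ℝ) * ∏ j ∈ Finset.range (s + 1 - 1), ((j : ℝ) + 1 / 2) =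
      ((s : ℝ) - 1 / 2) * ((1 / 2 : ℝ) * ∏ j ∈ Finset.range (s - 1), ((j : ℝ) + 1 / 2)) := by
  obtain ⟨s', rfl⟩ : ∃ s', s = s' + 1 := ⟨s - 1, by omega⟩
  simp only [Nat.add_sub_cancel]
  rw [Finset.prod_range_succ]
  push_cast
  ring

omit [Fintype d] [DecidableEq d] in
/-- `W_s > 0`. [cite: ArmstrongVicol2025, App. A Prop. 7.11 ((−1)^{n−1}binom(½,n) > 0)] -/
theorem avWeight_pos (s : ℕ) : 0 < (1 / 2 : ℝ) * ∏ j ∈ Finset.range (s - 1), ((j : ℝ) + 1 / 2) :=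
  mul_pos (by norm_num) (Finset.prod_pos fun j _ => by positivity)

omit [Fintype d] [DecidableEq d] in
/-- `Π_{j<s}(j+½) = 2(s−½)W_s` for `s ≥ 1`. [cite: ArmstrongVicol2025, App. A Lemma 7.3 (right side)] -/
theorem prod_range_half_eq {s : ℕ} (hs : 1 ≤ s) :
    ∏ j ∈ Finset.range s, ((j : ℝ) + 1 / 2) =
      2 * ((s : ℝ) - 1 / 2) * ((1 / 2 : ℝ) * ∏ j ∈ Finset.range (s - 1), ((j : ℝ) + 1 / 2)) := by
  obtain ⟨s', rfl⟩ : ∃ s', s = s' + 1 := ⟨s - 1, by omega⟩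
  simp only [Nat.add_sub_cancel]
  rw [Finset.prod_range_succ]
  push_cast
  ring

omit [Fintype d] [DecidableEq d] in
/-- `Π_{j<m}(j+2) = (m+1)!`. [folklore] -/
private theorem prod_range_add_two : ∀ m : ℕ, ∏ j ∈ Finset.range m, ((j : ℝ) + 2) = ((m + 1)! : ℝ)
  | 0 => by simp
  | m + 1 => by
    rw [Finset.prod_range_succ, prod_range_add_two m, Nat.factorial_succ (m + 1)]
    push_cast
    ring

omit [Fintype d] [DecidableEq d] in
/-- `4 W_{n+1} ≤ n!` for `n ≥ 1` (`4|binom(½,n+1)|(n+1)! ≤ n!`). [cite: ArmstrongVicol2025, App. A Prop. 7.11 (4(−1)^{n−1}binom(½,n) ≤ 1/n)] -/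
theorem four_mul_avWeight_succ_le_factorial {n : ℕ} (hn : 1 ≤ n) :
    4 * ((1 / 2 : ℝ) * ∏ j ∈ Finset.range (n + 1 - 1), ((j : ℝ) + 1 / 2)) ≤ (n ! : ℝ) := by
  simp only [Nat.add_sub_cancel]
  obtain ⟨n', rfl⟩ : ∃ n', n = n' + 1 := ⟨n - 1, by omega⟩
  rw [Finset.prod_range_succ']
  have h : ∏ j ∈ Finset.range n', (((j + 1 : ℕ) : ℝ) + 1 / 2) ≤ ∏ j ∈ Finset.range n', ((j : ℝ) + 2) :=
    Finset.prod_le_prod (fun j _ => by positivity) fun j _ => by push_cast; linarith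
  rw [prod_range_add_two n'] at h
  have h0 : 0 ≤ ∏ j ∈ Finset.range n', (((j + 1 : ℕ) : ℝ) + 1 / 2) := Finset.prod_nonneg fun j _ => by positivity
  push_cast at h h0 ⊢
  nlinarith [h, h0]

/-! ## §2 First-order consequences of `⟦f⟧_{1,R_f} ≤ C_f` -/

/-- `|∂ₘ fᵢ(z)| ≤ C_f R_f/4` from `⟦f⟧_{1,R_f} ≤ C_f`. [cite: ArmstrongVicol2025, App. A (A.1) with n = 1] -/
theorem abs_partialDeriv_apply_le_of_dnorm_one {g : UnitAddTorus d → EuclideanSpace ℝ d} (hg : IsSmooth g)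
    {Cf Rf : ℝ} (hRf : 0 < Rf) (h : dnorm 1 Rf g ≤ Cf) (m i : d) (z : UnitAddTorus d) :
    |partialDeriv m (fun y => g y i) z| ≤ Cf * Rf / 4 := by
  classical
  have h1 := norm_iterPartialDeriv_le_of_dnorm_le hg hRf h (l := [m]) rfl z
  simp only [iterPartialDeriv_cons, iterPartialDeriv_nil, Nat.factorial_one, Nat.cast_one, one_mul, pow_one] at h1
  rw [partialDeriv_apply_coord (hg.isContDiff (by simp)), ← Real.norm_eq_abs]
  refine (PiLp.norm_apply_le _ i).trans (h1.trans (le_of_eq ?_))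
  norm_num

/-! ## §3 The base case: `|∂ₖDᵢ(t,x)| ≤ 8dC_fR_f t` on `[0,T]` -/

variable {f D : ℝ → UnitAddTorus d → EuclideanSpace ℝ d} {Cf Rf : ℝ} {N : ℕ}

/-- `e^{x} ≤ 16/15` for `0 ≤ x ≤ 1/16`. [folklore] -/
private theorem exp_le_of_le_sixteenth {x : ℝ} (h : x ≤ 1 / 16) : Real.exp x ≤ 16 / 15 := by
  have h1 : Real.exp (1 / 16 : ℝ) < 1 / (1 - 1 / 16) := Real.exp_bound_div_one_sub_of_interval' (by norm_num) (by norm_num)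
  have h2 : Real.exp x ≤ Real.exp (1 / 16 : ℝ) := Real.exp_le_exp.2 h
  have h3 : (1 : ℝ) / (1 - 1 / 16) = 16 / 15 := by norm_num
  linarith [h3 ▸ h1]

/-- **Prop. 7.10, first display, on `[0,T]`**: `|∂ₖDᵢ(t,x)| ≤ 8 d C_f R_f t` for `0 ≤ t ≤ T = 1/(4dC_fR_f)`
(Grönwall on the variational equation `∂ₜ∇D = (∇f∘X)(1 + ∇D)`, `|∂ₘfᵢ| ≤ C_fR_f/4`, `e^{1/16} < 16/15`).
[cite: ArmstrongVicol2025, App. A Prop. 7.10 ((eq:grad:psi))] -/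
theorem abs_partialDeriv_disp_le_forward (hCf : 0 < Cf) (hRf : 0 < Rf) (hN : 1 ≤ N)
    (hf : IsSmoothSpaceTimeOn univ f) (hD : IsSmoothSpaceTimeOn univ D) (hD0 : ∀ x, D 0 x = 0)
    (hODE : ∀ t x, HasDerivAt (fun s => D s x) (f t (x + proj (D t x))) t)
    (hfb : ∀ n, 1 ≤ n → n ≤ N → ∀ t, dnorm n Rf (f t) ≤ Cf)
    {t : ℝ} (ht : t ∈ Icc 0 (1 / (4 * (Fintype.card d : ℝ) * Cf * Rf))) (k i : d) (x : UnitAddTorus d) :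
    |partialDeriv k (fun y => D t y i) x| ≤ 8 * (Fintype.card d : ℝ) * Cf * Rf * t := by
  classical
  set dd : ℝ := (Fintype.card d : ℝ) with hdd
  have hdd1 : 1 ≤ dd := by
    have : Nonempty d := ⟨k⟩
    have hcard : 1 ≤ Fintype.card d := Nat.succ_le_of_lt Fintype.card_pos
    rw [hdd]; exact_mod_cast hcard
  -- the curve of the column `(∂ₖDᵢ)ᵢ` in the sup norm
  set y : ℝ → d → ℝ := fun u i => partialDeriv k (fun z => D u z i) x with hy
  set y' : ℝ → d → ℝ := fun u i => ∑ m, partialDeriv m (fun z => f u z i) (x + proj (D u x)) *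
    ((1 : Matrix d d ℝ) m k + partialDeriv k (fun z => D u z m) x) with hy'
  have hyd : ∀ u, HasDerivAt y (y' u) u := fun u =>
    hasDerivAt_pi.2 fun i => hasDerivAt_partialDeriv_disp hf hD hODE i k u x
  have hy0 : y 0 = 0 := by
    funext i
    simp only [hy, Pi.zero_apply]
    have h : (fun z => D 0 z i) = fun _ => (0 : ℝ) := funext fun z => by rw [hD0 z]; rfl
    rw [h]
    have := iterPartialDeriv_const (d := d) (0 : ℝ) [k] (by simp)
    simpa using congrFun this x
  set Kc : ℝ := dd * (Cf * Rf / 4) with hKc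
  have hKc0 : 0 ≤ Kc := by positivity
  have hb : ∀ u ∈ Ico 0 (1 / (4 * dd * Cf * Rf)), ‖y' u‖ ≤ Kc * ‖y u‖ + Cf * Rf / 4 := by
    intro u _
    refine (pi_norm_le_iff_of_nonneg (by positivity)).2 fun i => ?_
    rw [Real.norm_eq_abs]
    have hfu : IsSmooth (f u) := hf.isSmooth_slice (mem_univ u)
    calc |y' u i| ≤ ∑ m, |partialDeriv m (fun z => f u z i) (x + proj (D u x)) *
            ((1 : Matrix d d ℝ) m k + partialDeriv k (fun z => D u z m) x)| := Finset.abs_sum_le_sum_abs _ _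
      _ ≤ ∑ m, Cf * Rf / 4 * ((1 : Matrix d d ℝ) m k + |y u m|) := by
          refine Finset.sum_le_sum fun m _ => ?_
          rw [abs_mul]
          refine mul_le_mul (abs_partialDeriv_apply_le_of_dnorm_one hfu hRf (hfb 1 le_rfl hN u) m i _) ?_
            (abs_nonneg _) (by positivity)
          refine (abs_add_le _ _).trans (add_le_add (le_of_eq ?_) le_rfl)
          rw [Matrix.one_apply]; split_ifs <;> simp
      _ = Cf * Rf / 4 * 1 + Cf * Rf / 4 * ∑ m, |y u m| := by
          rw [← Finset.mul_sum, Finset.sum_add_distrib, mul_add]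
          congr 2
          rw [Finset.sum_eq_single k (fun m _ hm => by rw [Matrix.one_apply_ne hm]) (fun h => (h (Finset.mem_univ k)).elim),
            Matrix.one_apply_eq]
      _ ≤ Cf * Rf / 4 * 1 + Cf * Rf / 4 * (dd * ‖y u‖) := by
          gcongr
          calc ∑ m, |y u m| ≤ ∑ _m : d, ‖y u‖ := Finset.sum_le_sum fun m _ => by
                rw [← Real.norm_eq_abs]; exact norm_le_pi_norm (y u) m
            _ = dd * ‖y u‖ := by rw [Finset.sum_const, Finset.card_univ, nsmul_eq_mul]
      _ = Kc * ‖y u‖ + Cf * Rf / 4 := by rw [hKc]; ring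
  have hG := norm_le_exp_mul_integral_of_norm_deriv_le hKc0 continuous_const (fun _ => by positivity) hyd hy0 hb ht
  rw [intervalIntegral.integral_const, smul_eq_mul, sub_zero] at hG
  -- `Kc t ≤ 1/16`
  have hT : t ≤ 1 / (4 * dd * Cf * Rf) := ht.2
  have hKt : Kc * t ≤ 1 / 16 := by
    have h1 : Kc * t ≤ Kc * (1 / (4 * dd * Cf * Rf)) := mul_le_mul_of_nonneg_left hT hKc0
    have h2 : Kc * (1 / (4 * dd * Cf * Rf)) = 1 / 16 := by rw [hKc]; field_simp; ring
    linarith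
  have hexp : Real.exp (Kc * t) ≤ 16 / 15 := exp_le_of_le_sixteenth hKt
  calc |partialDeriv k (fun y => D t y i) x| = |y t i| := rfl
    _ ≤ ‖y t‖ := by rw [← Real.norm_eq_abs]; exact norm_le_pi_norm (y t) i
    _ ≤ Real.exp (Kc * t) * (t * (Cf * Rf / 4)) := hG
    _ ≤ 16 / 15 * (t * (Cf * Rf / 4)) := mul_le_mul_of_nonneg_right hexp (by nlinarith [ht.1, hCf, hRf])
    _ ≤ 8 * dd * Cf * Rf * t := by nlinarith [ht.1, hCf, hRf, hdd1, mul_nonneg (mul_nonneg hCf.le hRf.le) ht.1]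

/-! ## §4 The induction on `[0,T]` -/

omit [Fintype d] [DecidableEq d] in
/-- `lift (h(· + proj E ·)) = lift h ∘ (id + lift E)`. [folklore] -/
private theorem lift_comp_eq' (h : UnitAddTorus d → ℝ) (E : UnitAddTorus d → EuclideanSpace ℝ d) :
    lift (fun y => h (y + proj (E y))) = lift h ∘ fun v => v + lift E v := by
  funext v
  rw [lift_apply, comp_apply, lift_apply, proj_add, lift_apply]

omit [Fintype d] [DecidableEq d] in
/-- `∫₀ᵗ (1+Bu)ˢ du ≤ (1+Bt)^{s+1}/(B(s+1))` for `B > 0`, `t ≥ 0`. [cite: ArmstrongVicol2025, App. A Prop. 7.11 (Grönwall step)] -/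
private theorem integral_one_add_mul_pow_le {B t : ℝ} (hB : 0 < B) (s : ℕ) :
    ∫ u in (0 : ℝ)..t, (1 + B * u) ^ s ≤ (1 + B * t) ^ (s + 1) / (B * ((s : ℝ) + 1)) := by
  have hderiv : ∀ u ∈ uIcc 0 t, HasDerivAt (fun u => (1 + B * u) ^ (s + 1) / (B * ((s : ℝ) + 1))) ((1 + B * u) ^ s) u := by
    intro u _
    have h1 : HasDerivAt (fun u => 1 + B * u) B u := by
      simpa using ((hasDerivAt_id u).const_mul B).const_add 1
    have h2 := (h1.pow (s + 1)).div_const (B * ((s : ℝ) + 1))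
    refine h2.congr_deriv ?_
    simp only [Nat.add_sub_cancel]
    field_simp
    push_cast
    ring
  rw [intervalIntegral.integral_eq_sub_of_hasDerivAt hderiv ((continuous_const.add (continuous_const.mul continuous_id)).pow s
    |>.intervalIntegrable 0 t)]
  simp only [mul_zero, add_zero, one_pow]
  have : 0 ≤ 1 / (B * ((s : ℝ) + 1)) := by positivity
  linarith
set_option maxHeartbeats 400000 in -- buildfix (bf3-g30): 160k/180k FAIL, 200k PASS at accept time; line-neutral budget line
/-- **The inductive bound (eq:Dn:Psi:induction) on `[0,T]`, componentwise**: for `1 ≤ s ≤ N`,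
`0 ≤ t ≤ T`, every word `K` of length `s`, every `v` and component `j`,
`|(Dˢ(id + D(t)∘proj)(v)(e_K))_j| ≤ W_s ρ_tˢ/((s+1)² d R_f)`, `ρ_t = 8dR_f(1 + 8dC_fR_f t)`.
[cite: ArmstrongVicol2025, App. A Prop. 7.11 ((eq:Dn:Psi:induction))] -/
theorem abs_iteratedFDeriv_flow_le_forward (hCf : 0 < Cf) (hRf : 0 < Rf)
    (hf : IsSmoothSpaceTimeOn univ f) (hD : IsSmoothSpaceTimeOn univ D) (hD0 : ∀ x, D 0 x = 0)
    (hODE : ∀ t x, HasDerivAt (fun s => D s x) (f t (x + proj (D t x))) t)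
    (hfb : ∀ n, 1 ≤ n → n ≤ N → ∀ t, dnorm n Rf (f t) ≤ Cf) :
    ∀ s, 1 ≤ s → s ≤ N → ∀ t ∈ Icc 0 (1 / (4 * (Fintype.card d : ℝ) * Cf * Rf)),
      ∀ (K : Fin s → d) (v : EuclideanSpace ℝ d) (j : d),
        |(iteratedFDeriv ℝ s (fun w => w + lift (D t) w) v (fun i => EuclideanSpace.single (K i) (1 : ℝ))) j| ≤
          ((1 / 2 : ℝ) * ∏ i ∈ Finset.range (s - 1), ((i : ℝ) + 1 / 2)) *
            (8 * (Fintype.card d : ℝ) * Rf * (1 + 8 * (Fintype.card d : ℝ) * Cf * Rf * t)) ^ s /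
            (((s : ℝ) + 1) ^ 2 * ((Fintype.card d : ℝ) * Rf)) := by
  classical
  intro s
  induction s using Nat.strong_induction_on with
  | h s ih =>
  intro hs1 hsN t ht K v j
  set dd : ℝ := (Fintype.card d : ℝ) with hdd
  have hdd1 : 1 ≤ dd := by
    have : Nonempty d := ⟨j⟩
    have hcard : 1 ≤ Fintype.card d := Nat.succ_le_of_lt Fintype.card_pos
    rw [hdd]; exact_mod_cast hcard
  set B : ℝ := 8 * dd * Cf * Rf with hB
  have hB0 : 0 < B := by positivity
  have hDt : ∀ u, IsSmooth (D u) := fun u => hD.isSmooth_slice (mem_univ u)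
  rcases Nat.lt_or_ge s 2 with hs | hs
  · ----- base `s = 1`
    obtain rfl : s = 1 := by omega
    rw [iteratedFDeriv_one_inner_eq (hDt t) K v]
    have hb := abs_partialDeriv_disp_le_forward hCf hRf hsN hf hD hD0 hODE hfb ht (K 0) j (proj v)
    simp only [Nat.sub_self, Finset.range_zero, Finset.prod_empty, mul_one, pow_one, Nat.cast_one]
    rw [PiLp.add_apply, PiLp.single_apply 2 ℝ (K 0) (1 : ℝ) j, partialDeriv_apply_coord ((hDt t).isContDiff (by simp))] at *
    have e : (1 / 2 : ℝ) * (8 * dd * Rf * (1 + 8 * dd * Cf * Rf * t)) / ((1 + 1) ^ 2 * (dd * Rf)) = 1 + B * t := by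
      rw [hB]; field_simp; ring
    rw [← partialDeriv_apply_coord ((hDt t).isContDiff (by simp))] at hb ⊢
    rw [e]
    refine (abs_add_le _ _).trans (add_le_add ?_ ?_)
    · split_ifs <;> simp
    · calc |partialDeriv (K 0) (fun y => D t y j) (proj v)| ≤ 8 * dd * Cf * Rf * t := hb
        _ = B * t := by rw [hB]
  · ----- step `s ≥ 2`
    set x : UnitAddTorus d := proj v with hx
    have hKne : List.ofFn K ≠ [] := by
      intro h; have := congrArg List.length h; simp at this; omega
    -- the curve of the word derivative, all components, sup norm
    set y : ℝ → d → ℝ := fun u i => iterPartialDeriv (List.ofFn K) (fun z => D u z i) x with hy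
    set y' : ℝ → d → ℝ := fun u i => iterPartialDeriv (List.ofFn K) (fun z => f u (z + proj (D u z)) i) x with hy'
    have hyd : ∀ u, HasDerivAt y (y' u) u := fun u =>
      hasDerivAt_pi.2 fun i => hasDerivAt_iterPartialDeriv_disp hD hODE (List.ofFn K) i u x
    have hy0 : y 0 = 0 := funext fun i => iterPartialDeriv_disp_zero hD0 hKne i x
    -- constants
    set Kc : ℝ := dd * (Cf * Rf / 4) with hKc
    have hKc0 : 0 ≤ Kc := by positivity
    set Ws : ℝ := (1 / 2 : ℝ) * ∏ i ∈ Finset.range (s - 1), ((i : ℝ) + 1 / 2) with hWs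
    have hWs0 : 0 < Ws := avWeight_pos s
    set ε : ℝ → ℝ := fun u => Cf * (8 * dd * Rf * (1 + B * |u|)) ^ s / ((s : ℝ) + 1) ^ 2 *
      ∏ i ∈ Finset.range s, ((i : ℝ) + 1 / 2) with hε
    have hP0 : 0 ≤ ∏ i ∈ Finset.range s, ((i : ℝ) + 1 / 2) := Finset.prod_nonneg fun i _ => by positivity
    have hε0 : ∀ u, 0 ≤ ε u := fun u => by
      simp only [hε]
      positivity
    have hεc : Continuous ε := by
      simp only [hε]
      fun_prop
    -- the differential inequality
    have hb : ∀ u ∈ Ico 0 (1 / (4 * dd * Cf * Rf)), ‖y' u‖ ≤ Kc * ‖y u‖ + ε u := by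
      intro u hu
      have huI : u ∈ Icc 0 (1 / (4 * dd * Cf * Rf)) := Ico_subset_Icc_self hu
      refine (pi_norm_le_iff_of_nonneg (by positivity [hε0 u])).2 fun i => ?_
      rw [Real.norm_eq_abs]
      have hfu : IsSmooth (f u) := hf.isSmooth_slice (mem_univ u)
      have hψ : IsSmooth (fun z => f u z i) := hfu.apply i
      have hG : ContDiff ℝ ∞ (fun w : EuclideanSpace ℝ d => w + lift (D u) w) := contDiff_id.add (hDt u)
      -- the word derivative of the composition as an iterated Fréchet derivative of the lifted composition
      have hcomp : IsSmooth (fun z => f u (z + proj (D u z)) i) := (isSmooth_comp_add_proj hfu (hDt u)).apply i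
      have e1 : y' u i = iteratedFDeriv ℝ s (lift (fun z => f u z i) ∘ fun w => w + lift (D u) w) v
          (fun t => EuclideanSpace.single (K t) (1 : ℝ)) := by
        simp only [hy']
        rw [← lift_comp_eq' (fun z => f u z i) (D u), iteratedFDeriv_lift_apply_single hcomp s K v]
      -- the remainder bound (E_old)
      have hrem := norm_faaDiBrunoRemainder_le_of_coord (n := s) hs hψ hG hCf.le hRf
        (ρ := 8 * dd * Rf * (1 + B * u))
        (mul_nonneg (by positivity) (by nlinarith [mul_nonneg hB0.le hu.1])) (b := 1 / 2)
        (fun s' => (1 / 2 : ℝ) * ∏ i ∈ Finset.range (s' - 1), ((i : ℝ) + 1 / 2)) (fun s' => (avWeight_pos s').le)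
        avWeight_one (fun s' hs' => avWeight_succ hs')
        (fun k hk hks => (dnorm_apply_le k hRf.le hfu i).trans (hfb k hk (hks.trans hsN) u))
        (fun s' hs' hs's K' v' j' => by
          have h := ih s' (by omega) hs' (by omega) u huI K' v' j'
          simpa only [hdd, hB] using h)
        K v
      -- the linear term
      have hlin : |_root_.fderiv ℝ (lift fun z => f u z i) (v + lift (D u) v)
          (iteratedFDeriv ℝ s (fun w => w + lift (D u) w) v (fun t => EuclideanSpace.single (K t) (1 : ℝ)))| ≤
          Kc * ‖y u‖ := by
        rw [fderiv_lift_apply_eq_sum (hψ.isContDiff (by simp)), iteratedFDeriv_inner_eq_iterPartialDeriv (hDt u) hs K v]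
        calc |∑ k, (iterPartialDeriv (List.ofFn K) (D u) (proj v)) k • partialDeriv k (fun z => f u z i) (proj (v + lift (D u) v))|
            ≤ ∑ k, |(iterPartialDeriv (List.ofFn K) (D u) (proj v)) k • partialDeriv k (fun z => f u z i) (proj (v + lift (D u) v))| :=
              Finset.abs_sum_le_sum_abs _ _
          _ ≤ ∑ k, ‖y u‖ * (Cf * Rf / 4) := by
              refine Finset.sum_le_sum fun k _ => ?_
              rw [smul_eq_mul, abs_mul]
              refine mul_le_mul ?_ (abs_partialDeriv_apply_le_of_dnorm_one hfu hRf (hfb 1 le_rfl (by omega) u) k i _)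
                (abs_nonneg _) (norm_nonneg _)
              have : (iterPartialDeriv (List.ofFn K) (D u) (proj v)) k = y u k := by
                simp only [hy, hx]
                rw [iterPartialDeriv_apply_coord (hDt u) k]
              rw [this, ← Real.norm_eq_abs]
              exact norm_le_pi_norm (y u) k
          _ = Kc * ‖y u‖ := by rw [Finset.sum_const, Finset.card_univ, nsmul_eq_mul, hKc, hdd]; ring
      -- assemble
      have hsplit : y' u i = _root_.fderiv ℝ (lift fun z => f u z i) (v + lift (D u) v)
            (iteratedFDeriv ℝ s (fun w => w + lift (D u) w) v (fun t => EuclideanSpace.single (K t) (1 : ℝ))) +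
          (iteratedFDeriv ℝ s (lift (fun z => f u z i) ∘ fun w => w + lift (D u) w) v (fun t => EuclideanSpace.single (K t) (1 : ℝ)) -
            _root_.fderiv ℝ (lift fun z => f u z i) (v + lift (D u) v)
              (iteratedFDeriv ℝ s (fun w => w + lift (D u) w) v (fun t => EuclideanSpace.single (K t) (1 : ℝ)))) := by
        rw [e1]; ring
      rw [hsplit]
      refine (abs_add_le _ _).trans (add_le_add hlin ?_)
      rw [← Real.norm_eq_abs]
      refine hrem.trans (le_of_eq ?_)
      simp only [hε, abs_of_nonneg hu.1]
    -- Grönwall with forcing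
    have hG := norm_le_exp_mul_integral_of_norm_deriv_le hKc0 hεc hε0 hyd hy0 hb ht
    -- the integral of the forcing
    have hT2 : B * t ≤ 2 := by
      have h1 : B * t ≤ B * (1 / (4 * dd * Cf * Rf)) := mul_le_mul_of_nonneg_left ht.2 hB0.le
      have h2 : B * (1 / (4 * dd * Cf * Rf)) = 2 := by rw [hB]; field_simp; ring
      linarith
    have hI : ∫ u in (0 : ℝ)..t, ε u ≤ Cf * (8 * dd * Rf) ^ s / ((s : ℝ) + 1) ^ 2 *
        (∏ i ∈ Finset.range s, ((i : ℝ) + 1 / 2)) * ((1 + B * t) ^ (s + 1) / (B * ((s : ℝ) + 1))) := by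
      have e : ∫ u in (0 : ℝ)..t, ε u = ∫ u in (0 : ℝ)..t, (Cf * (8 * dd * Rf) ^ s / ((s : ℝ) + 1) ^ 2 *
          ∏ i ∈ Finset.range s, ((i : ℝ) + 1 / 2)) * (1 + B * u) ^ s := by
        refine intervalIntegral.integral_congr fun u hu => ?_
        rw [uIcc_of_le ht.1] at hu
        simp only [hε, abs_of_nonneg hu.1]
        rw [mul_pow]
        ring
      rw [e, intervalIntegral.integral_const_mul]
      exact mul_le_mul_of_nonneg_left (integral_one_add_mul_pow_le hB0 s) (by positivity)
    -- `e^{Kc t} ≤ 16/15`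
    have hKt : Kc * t ≤ 1 / 16 := by
      have h1 : Kc * t ≤ Kc * (1 / (4 * dd * Cf * Rf)) := mul_le_mul_of_nonneg_left ht.2 hKc0
      have h2 : Kc * (1 / (4 * dd * Cf * Rf)) = 1 / 16 := by rw [hKc]; field_simp; ring
      linarith
    have hexp : Real.exp (Kc * t) ≤ 16 / 15 := exp_le_of_le_sixteenth hKt
    -- identify the left side with `|y t j|`
    have hyj : (iteratedFDeriv ℝ s (fun w => w + lift (D t) w) v (fun i => EuclideanSpace.single (K i) (1 : ℝ))) j = y t j := by
      rw [iteratedFDeriv_inner_eq_iterPartialDeriv (hDt t) hs K v]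
      simp only [hy, hx]
      rw [iterPartialDeriv_apply_coord (hDt t) j]
    rw [hyj]
    have hI0 : 0 ≤ ∫ u in (0 : ℝ)..t, ε u := intervalIntegral.integral_nonneg ht.1 fun u _ => hε0 u
    -- the closing arithmetic
    have hratio : 2 * ((s : ℝ) - 1 / 2) / ((s : ℝ) + 1) ≤ 2 := by
      rw [div_le_iff₀ (by positivity)]; linarith
    have hratio0 : 0 ≤ 2 * ((s : ℝ) - 1 / 2) / ((s : ℝ) + 1) := by
      apply div_nonneg _ (by positivity)
      have : (2 : ℝ) ≤ s := by exact_mod_cast hs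
      linarith
    have e8 : Cf * dd * Rf / B = 1 / 8 := by
      rw [div_eq_iff hB0.ne', hB]; ring
    have h1t : 0 ≤ 1 + B * t := by nlinarith [mul_nonneg hB0.le ht.1]
    have hρs : (8 * dd * Rf * (1 + 8 * dd * Cf * Rf * t)) ^ s = (8 * dd * Rf) ^ s * (1 + B * t) ^ s := by
      rw [← mul_pow, hB]
    set M : ℝ := Ws * (8 * dd * Rf * (1 + 8 * dd * Cf * Rf * t)) ^ s / (((s : ℝ) + 1) ^ 2 * (dd * Rf)) with hM
    have hM0 : 0 ≤ M := by
      rw [hM, hρs]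
      exact div_nonneg (mul_nonneg hWs0.le (mul_nonneg (by positivity) (pow_nonneg h1t s))) (by positivity)
    have e2 : 16 / 15 * (Cf * (8 * dd * Rf) ^ s / ((s : ℝ) + 1) ^ 2 *
        (∏ i ∈ Finset.range s, ((i : ℝ) + 1 / 2)) * ((1 + B * t) ^ (s + 1) / (B * ((s : ℝ) + 1)))) =
        M * (16 / 15 * (2 * ((s : ℝ) - 1 / 2) / ((s : ℝ) + 1)) * (1 + B * t) * (Cf * dd * Rf / B)) := by
      rw [prod_range_half_eq (by omega : 1 ≤ s), ← hWs, hM, hρs, pow_succ]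
      set A : ℝ := (8 * dd * Rf) ^ s
      set P : ℝ := (1 + B * t) ^ s
      field_simp
      ring
    calc |y t j| ≤ ‖y t‖ := by rw [← Real.norm_eq_abs]; exact norm_le_pi_norm (y t) j
      _ ≤ Real.exp (Kc * t) * ∫ u in (0 : ℝ)..t, ε u := hG
      _ ≤ 16 / 15 * (Cf * (8 * dd * Rf) ^ s / ((s : ℝ) + 1) ^ 2 *
          (∏ i ∈ Finset.range s, ((i : ℝ) + 1 / 2)) * ((1 + B * t) ^ (s + 1) / (B * ((s : ℝ) + 1)))) :=
          mul_le_mul hexp hI hI0 (by norm_num)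
      _ = M * (16 / 15 * (2 * ((s : ℝ) - 1 / 2) / ((s : ℝ) + 1)) * (1 + B * t) * (Cf * dd * Rf / B)) := e2
      _ ≤ M * 1 := by
          refine mul_le_mul_of_nonneg_left ?_ hM0
          rw [e8]
          have h1t : 0 ≤ 1 + B * t := by nlinarith [ht.1, hB0]
          calc 16 / 15 * (2 * ((s : ℝ) - 1 / 2) / ((s : ℝ) + 1)) * (1 + B * t) * (1 / 8)
              ≤ 16 / 15 * 2 * 3 * (1 / 8) := by
                have := mul_le_mul hratio (by linarith : 1 + B * t ≤ 3) h1t (by norm_num)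
                nlinarith [this, hratio0, h1t]
            _ ≤ 1 := by norm_num
      _ = M := mul_one M

/-! ## §5 Time reversal -/

section Reversal

variable {F : Type*} [NormedAddCommGroup F] [NormedSpace ℝ F]

omit [DecidableEq d] in
/-- Reversing time preserves joint smoothness. [folklore] -/
private theorem isSmoothSpaceTimeOn_reverse {u : ℝ → UnitAddTorus d → F} (hu : IsSmoothSpaceTimeOn univ u) :
    IsSmoothSpaceTimeOn univ (fun s => u (-s)) := by
  have hlin : ContDiff ℝ ∞ (fun p : ℝ × EuclideanSpace ℝ d => ((-p.1 : ℝ), p.2)) :=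
    (contDiff_neg.comp contDiff_fst).prodMk contDiff_snd
  have h : stLift (fun s => u (-s)) = stLift u ∘ fun p : ℝ × EuclideanSpace ℝ d => ((-p.1 : ℝ), p.2) := by
    funext p; rfl
  show ContDiffOn ℝ ∞ (stLift fun s => u (-s)) (univ ×ˢ univ)
  rw [h, univ_prod_univ]
  have hu' : ContDiff ℝ ∞ (stLift u) := by
    rw [← contDiffOn_univ, ← univ_prod_univ]; exact hu
  exact (hu'.comp hlin).contDiffOn

omit [Fintype d] in
/-- `∂^l (−g) = −∂^l g`. [folklore] -/
private theorem iterPartialDeriv_neg' (g : UnitAddTorus d → F) :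
    ∀ l : List d, iterPartialDeriv l (fun y => -g y) = fun y => -iterPartialDeriv l g y
  | [] => rfl
  | i :: l => by
    rw [iterPartialDeriv_cons, iterPartialDeriv_neg' g l, iterPartialDeriv_cons]
    funext x
    exact partialDeriv_neg i _ x

/-- `⟦−g⟧_{n,R} ≤ C` from `⟦g⟧_{n,R} ≤ C`. [cite: ArmstrongVicol2025, App. A (A.1)] -/
private theorem dnorm_neg_le {g : UnitAddTorus d → F} (hg : IsSmooth g) {n : ℕ} {R C : ℝ} (hR : 0 < R) (hC : 0 ≤ C)
    (h : dnorm n R g ≤ C) : dnorm n R (fun y => -g y) ≤ C := by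
  refine dnorm_le_of_forall_norm_iterPartialDeriv_le hR hC fun l hl y => ?_
  rw [iterPartialDeriv_neg' g l, norm_neg]
  exact norm_iterPartialDeriv_le_of_dnorm_le hg hR h hl y

end Reversal

/-- **Time reversal of the flow data**: `D̃(s) = D(−s)`, `f̃(s) = −f(−s)` satisfy the same hypotheses.
[cite: ArmstrongVicol2025, App. A Prop. 7.11 ("without loss of generality 0 ≤ t ≤ T")] -/
theorem reverse_data (hCf : 0 < Cf) (hRf : 0 < Rf)
    (hf : IsSmoothSpaceTimeOn univ f) (hD : IsSmoothSpaceTimeOn univ D) (hD0 : ∀ x, D 0 x = 0)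
    (hODE : ∀ t x, HasDerivAt (fun s => D s x) (f t (x + proj (D t x))) t)
    (hfb : ∀ n, 1 ≤ n → n ≤ N → ∀ t, dnorm n Rf (f t) ≤ Cf) :
    IsSmoothSpaceTimeOn univ (fun s y => -f (-s) y) ∧ IsSmoothSpaceTimeOn univ (fun s => D (-s)) ∧
      (∀ x, (fun s => D (-s)) 0 x = 0) ∧
      (∀ t x, HasDerivAt (fun s => (fun s => D (-s)) s x)
        ((fun s y => -f (-s) y) t (x + proj ((fun s => D (-s)) t x))) t) ∧
      (∀ n, 1 ≤ n → n ≤ N → ∀ t, dnorm n Rf ((fun s y => -f (-s) y) t) ≤ Cf) := by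
  refine ⟨(isSmoothSpaceTimeOn_reverse hf).neg, isSmoothSpaceTimeOn_reverse hD, fun x => by simp [hD0 x], ?_, ?_⟩
  · intro t x
    have h := (hODE (-t) x).scomp t (hasDerivAt_neg t)
    simpa [Function.comp_def] using h
  · intro n hn hnN t
    exact dnorm_neg_le (hf.isSmooth_slice (mem_univ (-t))) hRf hCf.le (hfb n hn hnN (-t))

/-- **The inductive bound for all `|t| ≤ T`** (both time directions).
[cite: ArmstrongVicol2025, App. A Prop. 7.11 ((eq:Dn:Psi:induction))] -/
theorem abs_iteratedFDeriv_flow_le (hCf : 0 < Cf) (hRf : 0 < Rf)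
    (hf : IsSmoothSpaceTimeOn univ f) (hD : IsSmoothSpaceTimeOn univ D) (hD0 : ∀ x, D 0 x = 0)
    (hODE : ∀ t x, HasDerivAt (fun s => D s x) (f t (x + proj (D t x))) t)
    (hfb : ∀ n, 1 ≤ n → n ≤ N → ∀ t, dnorm n Rf (f t) ≤ Cf)
    {s : ℕ} (hs1 : 1 ≤ s) (hsN : s ≤ N) {t : ℝ} (ht : |t| ≤ 1 / (4 * (Fintype.card d : ℝ) * Cf * Rf))
    (K : Fin s → d) (v : EuclideanSpace ℝ d) (j : d) :
    |(iteratedFDeriv ℝ s (fun w => w + lift (D t) w) v (fun i => EuclideanSpace.single (K i) (1 : ℝ))) j| ≤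
      ((1 / 2 : ℝ) * ∏ i ∈ Finset.range (s - 1), ((i : ℝ) + 1 / 2)) *
        (8 * (Fintype.card d : ℝ) * Rf * (1 + 8 * (Fintype.card d : ℝ) * Cf * Rf * |t|)) ^ s /
        (((s : ℝ) + 1) ^ 2 * ((Fintype.card d : ℝ) * Rf)) := by
  rcases le_or_gt 0 t with h0 | h0
  · rw [abs_of_nonneg h0] at ht ⊢
    exact abs_iteratedFDeriv_flow_le_forward hCf hRf hf hD hD0 hODE hfb s hs1 hsN t ⟨h0, ht⟩ K v j
  · obtain ⟨hf', hD', hD0', hODE', hfb'⟩ := reverse_data hCf hRf hf hD hD0 hODE hfb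
    rw [abs_of_neg h0] at ht ⊢
    have h := abs_iteratedFDeriv_flow_le_forward (D := fun s => D (-s)) (f := fun s y => -f (-s) y)
      hCf hRf hf' hD' hD0' hODE' hfb' s hs1 hsN (-t) ⟨by linarith, ht⟩ K v j
    simpa only [neg_neg] using h

/-! ## §6 The discharge -/

/-- **Armstrong–Vicol, App. A Prop. 7.11 — proved**: for the flow `X = id + proj∘D` of a field with
`⟦f(t)⟧_{n,R_f} ≤ C_f` (`1 ≤ n ≤ N`), every `|t| ≤ 1/(4dC_fR_f)` and `1 ≤ n ≤ N − 1`: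
`⟦(∇X)_{ij}(t,·)⟧_{n, 8dR_f(1+8dC_fR_f|t|)} ≤ 6d`.
[cite: ArmstrongVicol2025, App. A Prop. 7.11 ((e.ODE.flow.estimate), arXiv §7.3 pp. 73–74)] -/
theorem ArmstrongVicol2025_flowGrad_holds :
    ∀ (d : Type*) [Fintype d] [DecidableEq d], ArmstrongVicol2025_flowGrad d := by
  intro d _ _ N f D Cf Rf hCf hRf hf hD hD0 hODE hfb n hn1 hnN t ht i j
  classical
  set dd : ℝ := (Fintype.card d : ℝ) with hdd
  have hdd1 : 1 ≤ dd := by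
    have : Nonempty d := ⟨i⟩
    have hcard : 1 ≤ Fintype.card d := Nat.succ_le_of_lt Fintype.card_pos
    rw [hdd]; exact_mod_cast hcard
  set ρ : ℝ := 8 * dd * Rf * (1 + 8 * dd * Cf * Rf * |t|) with hρ
  have hBt : 8 * dd * Cf * Rf * |t| ≤ 2 := by
    have h1 : 8 * dd * Cf * Rf * |t| ≤ 8 * dd * Cf * Rf * (1 / (4 * dd * Cf * Rf)) :=
      mul_le_mul_of_nonneg_left ht (by positivity)
    have h2 : 8 * dd * Cf * Rf * (1 / (4 * dd * Cf * Rf)) = 2 := by field_simp; ring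
    linarith
  have hρ0 : 0 < ρ := by positivity
  have hρle : ρ ≤ 24 * dd * Rf := by
    rw [hρ]; nlinarith [hBt, mul_pos (mul_pos (by norm_num : (0:ℝ) < 8) (by linarith : (0:ℝ) < dd)) hRf]
  have hDt : IsSmooth (D t) := hD.isSmooth_slice (mem_univ t)
  have hDti : IsSmooth (fun x => D t x i) := hDt.apply i
  refine dnorm_le_of_forall_norm_iterPartialDeriv_le hρ0 (by positivity) fun l hl y => ?_
  obtain ⟨v, rfl⟩ := proj_surjective y
  have hlne : l ≠ [] := by intro h; subst h; simp at hl; omega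
  -- `∂^l (δ_ij + ∂_j D_i) = ∂^{l ++ [j]} D_i`
  have e1 : iterPartialDeriv l (fun y => (1 : Matrix d d ℝ) i j + partialDeriv j (fun x => D t x i) y) (proj v) =
      iterPartialDeriv (l ++ [j]) (fun x => D t x i) (proj v) := by
    rw [iterPartialDeriv_concat,
      iterPartialDeriv_add (isSmooth_const ((1 : Matrix d d ℝ) i j)) (hDti.partialDeriv j) l]
    simp only
    rw [iterPartialDeriv_const ((1 : Matrix d d ℝ) i j) l hlne, Pi.zero_apply, zero_add]
  -- the word `l ++ [j]` of length `n + 1` as `List.ofFn K`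
  have hlen : (l ++ [j]).length = n + 1 := by simp [hl]
  set K : Fin (n + 1) → d := fun k => (l ++ [j]).get (Fin.cast hlen.symm k) with hK
  have eK : List.ofFn K = l ++ [j] := by
    refine List.ext_get (by rw [List.length_ofFn, hlen]) fun k h1 h2 => ?_
    rw [List.get_ofFn]
    rfl
  have e2 : iterPartialDeriv (l ++ [j]) (fun x => D t x i) (proj v) =
      (iteratedFDeriv ℝ (n + 1) (fun w => w + lift (D t) w) v (fun k => EuclideanSpace.single (K k) (1 : ℝ))) i := by
    rw [iteratedFDeriv_inner_eq_iterPartialDeriv hDt (by omega) K v, eK, iterPartialDeriv_apply_coord hDt i]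
  have key := abs_iteratedFDeriv_flow_le hCf hRf hf hD hD0 hODE hfb (s := n + 1) (by omega) hnN ht K v i
  rw [Real.norm_eq_abs, e1, e2]
  refine key.trans ?_
  rw [← hdd, ← hρ]
  -- arithmetic: `W_{n+1} ρ^{n+1}/((n+2)² d R_f) ≤ 6d · n! ρⁿ/(n+1)²`
  have hW := four_mul_avWeight_succ_le_factorial hn1
  have hW0 := (avWeight_pos (n + 1)).le
  set W : ℝ := (1 / 2 : ℝ) * ∏ i ∈ Finset.range (n + 1 - 1), ((i : ℝ) + 1 / 2) with hWdef
  have hn2 : ((n : ℝ) + 1) ^ 2 ≤ (((n + 1 : ℕ) : ℝ) + 1) ^ 2 := by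
    push_cast; nlinarith [(Nat.cast_nonneg n : (0 : ℝ) ≤ n)]
  calc W * ρ ^ (n + 1) / ((((n + 1 : ℕ) : ℝ) + 1) ^ 2 * (dd * Rf))
      = (W * ρ) * (ρ ^ n / ((((n + 1 : ℕ) : ℝ) + 1) ^ 2 * (dd * Rf))) := by rw [pow_succ]; ring
    _ ≤ ((n ! : ℝ) / 4 * (24 * dd * Rf)) * (ρ ^ n / (((n : ℝ) + 1) ^ 2 * (dd * Rf))) := by
        refine mul_le_mul ?_ ?_ (by positivity) (by positivity)
        · exact mul_le_mul (by linarith) hρle hρ0.le (by positivity)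
        · exact div_le_div_of_nonneg_left (by positivity) (by positivity)
            (mul_le_mul_of_nonneg_right hn2 (by positivity))
    _ = 6 * ((n ! : ℝ) * ρ ^ n) / ((n : ℝ) + 1) ^ 2 := by field_simp; norm_num
    _ ≤ 6 * dd * ((n ! : ℝ) * ρ ^ n) / ((n : ℝ) + 1) ^ 2 := by
        refine div_le_div_of_nonneg_right ?_ (by positivity)
        nlinarith [hdd1, show 0 ≤ (n ! : ℝ) * ρ ^ n by positivity]

end TorusFlow

end Literature.Analysis.ODE

end
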